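import Mathlib
import Summits.Ventures.HodgeRepro2.Tier7.Line3.LevelInvariantOrbital

/-!
# Tier7/Line3/UnramifiedFactor — the three per-place clauses at an unramified inert place
(seat t7-x1, gen 4; the per-place input of LocalFactorProduct at the places where «the factor is 1 on the support»)

LINE 3 (t7-plan-3), version (ii). LocalFactorProduct takes, at each place `w ≠ v₁`, a local factor `b w : Orb → ℂ` with
three clauses — support (`b w γ ≠ 0 → arith w γ`), bound (`arith w γ → ‖b w γ‖ ≤ C w (1 + size γ)^(ε w) ‖b w γ₀‖`) and
non-vanishing at `γ₀`. At an UNRAMIFIED INERT place (both tori inside the maximal compact `K_w`, the local characters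
trivial, the test function `1_{K_w}`) the factor is the twisted orbital integral `orbital μA μB ιA ιB χA ψB 1_{K} (loc γ)` of
LevelInvariantOrbital p692410, and the three clauses are THEOREMS of that module's unramified lemmas:

* `unramifiedFactor_support`: `b γ ≠ 0 → InSupport ιA ιB 1 K (loc γ)` (`inSupport_of_orbital_indicator_ne_zero`);
* `unramifiedFactor_bound`: on the support `‖b γ‖ = ‖b 1‖ = ‖b γ₀‖` (`norm_orbital_indicator_eq_of_le`; `loc γ₀` in the
  support displayed), so the bound holds with `C = 1`, `ε = 0`: `‖b γ‖ ≤ 1 · (1 + size γ)^0 · ‖b γ₀‖`;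
* `unramifiedFactor_γ₀`: `b γ₀ ≠ 0` — `‖b γ₀‖ = ‖b 1‖ = vol(A) · vol(B) ≠ 0` for finite Haar measures with positive total
  mass (`orbital_indicator_one_of_le_of_trivial`);
* `unramifiedFactor_clauses`: the three together, in the binder shape of LocalFactorProduct's per-place hypotheses.

DICTIONARY (in words): `w` an inert place of `E⁺` unramified for the datum, `A, B = T_A(E⁺_w), T_B(E⁺_w)` inside `K_w =
GL₂(𝓞_{E,w}) ∩ U(W_A)`, `χA = μ_{A,w}`, `ψB = μ_{B,w}⁻¹` trivial (unramified characters of compact tori), `loc γ` the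
`w`-component of the double coset, `loc γ₀ ∈ K_w` the integrality of the dominant coset at `w`; the finite set of places
outside which this applies is the standard normalisation «almost all factors = 1» (memo l. 334). Nothing here is about
(N), (P), the real `X`, or HC_CM; §8(d): NO. Blind lane: Mathlib + the HodgeRepro2 prefix; no sorry;
axioms ⊆ {propext, Classical.choice, Quot.sound}.
-/

namespace Summit.Ventures.HodgeRepro2.Tier7.Line3.UnramifiedFactor

open MeasureTheory
  Summit.Ventures.HodgeRepro2.Tier7.Line3.LevelInvariantOrbital

variable {A B G : Type*} [Group A] [Group B] [Group G]
  [MeasurableSpace A] [MeasurableMul A] [MeasurableSpace B] [MeasurableMul B]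
  (μA : Measure A) [μA.IsMulLeftInvariant] (μB : Measure B) [μB.IsMulLeftInvariant]
  (ιA : A →* G) (ιB : B →* G) (χA : A →* ℂ) (ψB : B →* ℂ) (K : Subgroup G)
  {Orb : Type*} (loc : Orb → G)

/-- the unramified local factor: the twisted orbital integral of `1_K` at the local component. -/
noncomputable def unramifiedFactor (γ : Orb) : ℂ :=
  orbital μA μB ιA ιB χA ψB ((coset 1 K).indicator fun _ => (1 : ℂ)) (loc γ)

omit [MeasurableMul A] [MeasurableMul B] [μA.IsMulLeftInvariant] [μB.IsMulLeftInvariant] in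
/-- **support**: a non-zero unramified factor forces the local component into `ι_A(A) K ι_B(B)`. -/
theorem unramifiedFactor_support (γ : Orb) (h : unramifiedFactor μA μB ιA ιB χA ψB K loc γ ≠ 0) :
    InSupport ιA ιB 1 K (loc γ) :=
  inSupport_of_orbital_indicator_ne_zero μA μB ιA ιB χA ψB 1 K (loc γ) h

/-- **constant norm on the support**: `‖b γ‖ = ‖b γ₀‖` whenever both local components lie in the support. -/
theorem norm_unramifiedFactor_eq (hχA : ∀ a, ‖χA a‖ = 1) (hψB : ∀ b, ‖ψB b‖ = 1) (hB : ∀ b, ιB b ∈ K)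
    (γ₀ γ : Orb) (hγ₀ : InSupport ιA ιB 1 K (loc γ₀)) (hγ : InSupport ιA ιB 1 K (loc γ)) :
    ‖unramifiedFactor μA μB ιA ιB χA ψB K loc γ‖ = ‖unramifiedFactor μA μB ιA ιB χA ψB K loc γ₀‖ := by
  unfold unramifiedFactor
  rw [norm_orbital_indicator_eq_of_le μA μB ιA ιB χA ψB hχA hψB K hB (loc γ) hγ,
    norm_orbital_indicator_eq_of_le μA μB ιA ιB χA ψB hχA hψB K hB (loc γ₀) hγ₀]

/-- **bound with `C = 1`, `ε = 0`** on the support. -/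
theorem unramifiedFactor_bound (hχA : ∀ a, ‖χA a‖ = 1) (hψB : ∀ b, ‖ψB b‖ = 1) (hB : ∀ b, ιB b ∈ K)
    (γ₀ : Orb) (hγ₀ : InSupport ιA ιB 1 K (loc γ₀)) (size : Orb → ℝ) (γ : Orb)
    (hγ : InSupport ιA ιB 1 K (loc γ)) :
    ‖unramifiedFactor μA μB ιA ιB χA ψB K loc γ‖ ≤
      1 * (1 + size γ) ^ (0 : ℝ) * ‖unramifiedFactor μA μB ιA ιB χA ψB K loc γ₀‖ := by
  rw [norm_unramifiedFactor_eq μA μB ιA ιB χA ψB K loc hχA hψB hB γ₀ γ hγ₀ hγ, Real.rpow_zero, one_mul, one_mul]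

/-- **non-vanishing at `γ₀`**: trivial characters, tori inside `K`, finite Haar measures of positive total mass, and the
dominant coset in the support ⇒ `b γ₀ = vol(A) · vol(B) ≠ 0` in norm. -/
theorem unramifiedFactor_γ₀ (hA : ∀ a, ιA a ∈ K) (hB : ∀ b, ιB b ∈ K) (hχA : ∀ a, χA a = 1) (hψB : ∀ b, ψB b = 1)
    [IsFiniteMeasure μA] [IsFiniteMeasure μB] (hμA : μA Set.univ ≠ 0) (hμB : μB Set.univ ≠ 0)
    (γ₀ : Orb) (hγ₀ : InSupport ιA ιB 1 K (loc γ₀)) :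
    unramifiedFactor μA μB ιA ιB χA ψB K loc γ₀ ≠ 0 := by
  have hχA' : ∀ a, ‖χA a‖ = 1 := fun a => by rw [hχA a, norm_one]
  have hψB' : ∀ b, ‖ψB b‖ = 1 := fun b => by rw [hψB b, norm_one]
  intro h0
  have h1 : ‖unramifiedFactor μA μB ιA ιB χA ψB K loc γ₀‖
      = ‖orbital μA μB ιA ιB χA ψB ((coset 1 K).indicator fun _ => (1 : ℂ)) 1‖ := by
    unfold unramifiedFactor
    exact norm_orbital_indicator_eq_of_le μA μB ιA ιB χA ψB hχA' hψB' K hB (loc γ₀) hγ₀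
  rw [h0, norm_zero, orbital_indicator_one_of_le_of_trivial μA μB ιA ιB χA ψB K hA hB hχA hψB] at h1
  have hA0 : ((μA.real Set.univ : ℝ) : ℂ) ≠ 0 := by
    exact_mod_cast (measureReal_ne_zero_iff (μ := μA) (s := Set.univ) (measure_ne_top _ _)).2 hμA
  have hB0 : ((μB.real Set.univ : ℝ) : ℂ) ≠ 0 := by
    exact_mod_cast (measureReal_ne_zero_iff (μ := μB) (s := Set.univ) (measure_ne_top _ _)).2 hμB
  exact (mul_ne_zero hA0 hB0) (norm_eq_zero.1 h1.symm)

/-- **the three per-place clauses at an unramified inert place**, in the binder shape of LocalFactorProduct's per-place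
hypotheses (`C = 1`, `ε = 0`, `arith := InSupport ιA ιB 1 K ∘ loc`). -/
theorem unramifiedFactor_clauses (hA : ∀ a, ιA a ∈ K) (hB : ∀ b, ιB b ∈ K) (hχA : ∀ a, χA a = 1) (hψB : ∀ b, ψB b = 1)
    [IsFiniteMeasure μA] [IsFiniteMeasure μB] (hμA : μA Set.univ ≠ 0) (hμB : μB Set.univ ≠ 0)
    (γ₀ : Orb) (hγ₀ : InSupport ιA ιB 1 K (loc γ₀)) (size : Orb → ℝ) :
    (∀ γ, unramifiedFactor μA μB ιA ιB χA ψB K loc γ ≠ 0 → InSupport ιA ιB 1 K (loc γ)) ∧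
    (∀ γ, InSupport ιA ιB 1 K (loc γ) → ‖unramifiedFactor μA μB ιA ιB χA ψB K loc γ‖ ≤
      1 * (1 + size γ) ^ (0 : ℝ) * ‖unramifiedFactor μA μB ιA ιB χA ψB K loc γ₀‖) ∧
    unramifiedFactor μA μB ιA ιB χA ψB K loc γ₀ ≠ 0 := by
  have hχA' : ∀ a, ‖χA a‖ = 1 := fun a => by rw [hχA a, norm_one]
  have hψB' : ∀ b, ‖ψB b‖ = 1 := fun b => by rw [hψB b, norm_one]
  exact ⟨fun γ h => unramifiedFactor_support μA μB ιA ιB χA ψB K loc γ h,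
    fun γ hγ => unramifiedFactor_bound μA μB ιA ιB χA ψB K loc hχA' hψB' hB γ₀ hγ₀ size γ hγ,
    unramifiedFactor_γ₀ μA μB ιA ιB χA ψB K loc hA hB hχA hψB hμA hμB γ₀ hγ₀⟩

end Summit.Ventures.HodgeRepro2.Tier7.Line3.UnramifiedFactor
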